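import Mathlib
import Summits.Ventures.HodgeRepro.GaussSumEvenConductor

/-!
# OcticCMPointEightModel — the ring `𝒪/𝔭⁸` at `𝔭₁, 𝔭₂ | 5` of the octic point: `ℤ/25[w]/(w⁴ + 5w² + 5)`

Blind re-derivation cell `pub-hodge-repro`, seat night-2 (gen 5).  Target tree path
`lean/Summits/Ventures/HodgeRepro/OcticCMPointEightModel.lean`.  The first ring beyond `c ≤ 4` at the ramified places
of `E = ℚ(ζ₅, √(4 + √5))` — the honest limit «`c ≥ 5` at `𝔭 | 5` (`ℤ/25`-algebras)» of gens 3–4 — transcribed at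
conductor `8`; the ideal of the stationary phase is in `OcticCMPointEightIdeal.lean`, the root numbers in
`OcticCMPointEightSign.lean`.

* **The ring.**  `K_v = ℚ₅(ζ₅)`, `ϖ = ζ₅ − ζ₅⁻¹` with minimal polynomial `X⁴ + 5X² + 5` over `ℤ₅` (Eisenstein:
  `s = ζ₅ + ζ₅⁻¹` satisfies `s² + s − 1 = 0` and `ϖ² = s² − 4 = −3 − s`), and `𝔭⁸ = (ϖ⁸) = (25)` in `ℤ₅[ϖ]`
  (`ϖ⁴ = −5(1 + ϖ²)`, `1 + ϖ²` a unit), so **`𝒪/𝔭⁸ = ℤ/25[w]/(w⁴ + 5w² + 5)`** (`R8`, `w`; `w⁸ = 0`,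
  `|R8| = 25⁴ = 5⁸`).  The conjugation of `K_v/k_v` (`k_v = ℚ₅(√5)`, `σ(ζ₅) = ζ₅⁻¹`) is `σ : w ↦ −w`
  (`conj`, an involution; the polynomial is even).
* **The additive character.**  `ψ̃ = ψ₂₅ ∘ top`, `top` = the `w³`-coordinate in the power basis `1, w, w², w³`,
  `ψ₂₅ = e(x/25)`: PRIMITIVE (the Gram matrix `G = !![0,0,0,1; 0,0,1,0; 0,1,0,20; 1,0,20,0]` of `(a, b) ↦ top(ab)`
  is invertible over `ℤ/25`, `G H = 1`), and `ψ̃ ∘ σ = ψ̃ ∘ (−1 ·)` (`top` is odd under `σ`) — the hypothesis `hψ`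
  of gen 3's `conjDual_ramified` at `c = 8`.

The identification of `ϖ`'s minimal polynomial is elementary (`numerics/eight_model.py` checks the tables).

**What this is not.**  Conductors `5`, `6`, `7` (quotients `R8/(w^c)` — no power-basis API) and the explicit
conductor-`8` twist (the truncated logarithm needs `1/5`, absent in `ℤ/25`) are NOT here.  Nothing here says anything
about the status of the Hodge conjecture for CM abelian varieties, which is NOT proved.
-/

set_option autoImplicit false

noncomputable section

open Polynomial Matrix Classical

namespace Summit.Ventures.HodgeRepro.PeriodCloser

namespace EightModel

open GaussSumStability

/-! ### The ring `R8 = ℤ/25[w]/(w⁴ + 5w² + 5)` -/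

/-- The minimal polynomial `X⁴ + 5X² + 5` of `ϖ = ζ₅ − ζ₅⁻¹`, over `ℤ/25`. -/
def f : (ZMod 25)[X] := X ^ 4 + 5 * X ^ 2 + 5

/-- `f` is monic. -/
theorem f_monic : f.Monic := by
  unfold f
  monicity!

/-- `natDegree f = 4`. -/
theorem f_natDegree : f.natDegree = 4 := by
  unfold f
  compute_degree!

/-- **The ring `𝒪/𝔭⁸ = ℤ/25[w]/(w⁴ + 5w² + 5)`**. -/
abbrev R8 : Type := AdjoinRoot f

/-- The uniformiser `w = ϖ`. -/
abbrev w : R8 := AdjoinRoot.root f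

/-- `aeval y f` in closed form. -/
theorem aeval_f (y : R8) : aeval y f = y ^ 4 + 5 * y ^ 2 + 5 := by
  show aeval y (X ^ 4 + 5 * X ^ 2 + 5) = _
  simp only [map_add, map_mul, map_pow, aeval_X, map_ofNat]

/-- The defining relation `w⁴ + 5w² + 5 = 0`. -/
theorem w_rel : w ^ 4 + 5 * w ^ 2 + 5 = 0 := by
  rw [← aeval_f, AdjoinRoot.aeval_eq, AdjoinRoot.mk_self]

/-- `25 = 0` in `R8`. -/
theorem twentyfive_eq_zero : (25 : R8) = 0 := by
  have h : (25 : ZMod 25) = 0 := by decide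
  rw [show (25 : R8) = algebraMap (ZMod 25) R8 25 from (map_ofNat (algebraMap (ZMod 25) R8) 25).symm, h,
    map_zero]

/-- `w⁸ = 0`: `𝔭⁸ = 0`. -/
theorem w_pow_eight : w ^ 8 = 0 := by
  have h := w_rel
  have h25 := twentyfive_eq_zero
  linear_combination (w ^ 4 - 5 * w ^ 2 - 5) * h + (w ^ 2 + 1) ^ 2 * h25

/-! ### The conjugation `σ : w ↦ −w` -/

/-- `−w` is a root of `f` (the polynomial is even). -/
theorem aeval_neg_w : aeval (-w) f = 0 := by
  rw [aeval_f]
  have h := w_rel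
  linear_combination h

/-- The root condition in the form `liftAlgHom` wants. -/
theorem eval₂_of_aeval {y : R8} (h : aeval y f = 0) :
    f.eval₂ ((Algebra.ofId (ZMod 25) R8 : ZMod 25 →ₐ[ZMod 25] R8) : ZMod 25 →+* R8) y = 0 := by
  show eval₂ (algebraMap (ZMod 25) R8) y f = 0
  rw [← Polynomial.aeval_def]
  exact h

/-- **The conjugation `σ : w ↦ −w`** of `K_v/k_v` on `𝒪/𝔭⁸`, a `ℤ/25`-algebra endomorphism. -/
def conj : R8 →ₐ[ZMod 25] R8 :=
  AdjoinRoot.liftAlgHom f (Algebra.ofId (ZMod 25) R8) (-w) (eval₂_of_aeval aeval_neg_w)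

/-- `σ(w) = −w`. -/
theorem conj_w : conj w = -w := AdjoinRoot.liftAlgHom_root _ _ _ _

/-- **`σ` is an involution.** -/
theorem conj_conj (y : R8) : conj (conj y) = y := by
  have h : conj.comp conj = AlgHom.id (ZMod 25) R8 := by
    apply AdjoinRoot.algHom_ext
    rw [AlgHom.comp_apply, conj_w, map_neg, conj_w, neg_neg, AlgHom.id_apply]
  exact AlgHom.congr_fun h y

/-- `σ` as a ring homomorphism. -/
def σ8 : R8 →+* R8 := conj.toRingHom

/-- `σ8 y = σ(y)`. -/
theorem σ8_apply (y : R8) : σ8 y = conj y := rfl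

/-! ### Finiteness, the power basis, the top coordinate -/

/-- The power basis `1, w, w², w³` of `R8` over `ℤ/25`. -/
def pb : PowerBasis (ZMod 25) R8 := AdjoinRoot.powerBasis' f_monic

/-- `pb.dim = 4`. -/
theorem pb_dim : pb.dim = 4 := by
  show f.natDegree = 4
  exact f_natDegree

/-- `R8` is a finite `ℤ/25`-module. -/
instance instModuleFiniteR8 : Module.Finite (ZMod 25) R8 := f_monic.finite_adjoinRoot

/-- `R8` is finite. -/
instance instFiniteR8 : Finite R8 := Module.finite_of_finite (ZMod 25)

/-- A `Fintype` instance on `R8`. -/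
instance instFintypeR8 : Fintype R8 := Fintype.ofFinite _

/-- **`|R8| = 25⁴ = 5⁸ = 390625`.** -/
theorem card_R8 : Fintype.card R8 = 390625 := by
  rw [Module.card_fintype pb.basis, ZMod.card, Fintype.card_fin, pb_dim]
  norm_num

/-- `pb.gen = w`. -/
theorem pb_gen : pb.gen = w := rfl

/-- `pb.basis i = w ^ i`. -/
theorem pb_basis_apply (i : Fin pb.dim) : pb.basis i = w ^ (i : ℕ) := by
  rw [pb.basis_eq_pow, pb_gen]

/-- The basis `1, w, w², w³`, indexed by `Fin 4`. -/
def b4 : Module.Basis (Fin 4) (ZMod 25) R8 := pb.basis.reindex (finCongr pb_dim)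

/-- `b4 i = w ^ i`. -/
theorem b4_apply (i : Fin 4) : b4 i = w ^ (i : ℕ) := by
  rw [b4, Module.Basis.reindex_apply, pb_basis_apply]
  rfl

/-- **The top coordinate** `top y` = the `w³`-coefficient of `y`, as a `ℤ/25`-linear map. -/
def topL : R8 →ₗ[ZMod 25] ZMod 25 := b4.coord 3

/-- The top coordinate as a function. -/
def top (y : R8) : ZMod 25 := topL y

/-- `top y = (b4.repr y) 3`. -/
theorem top_apply (y : R8) : top y = b4.repr y 3 := by
  unfold top topL
  rw [Module.Basis.coord_apply]

/-- `top` is additive. -/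
theorem top_add (y z : R8) : top (y + z) = top y + top z := by
  unfold top; exact map_add topL y z

/-- `top (c • y) = c * top y`. -/
theorem top_smul (c : ZMod 25) (y : R8) : top (c • y) = c * top y := by
  unfold top; rw [map_smul, smul_eq_mul]

/-- `top (−y) = −top y`. -/
theorem top_neg (y : R8) : top (-y) = -top y := by
  unfold top; exact map_neg topL y

/-- `(c : ℤ/25) • y = algebraMap c * y`. -/
theorem smul_eq_num (c : ZMod 25) (y : R8) : c • y = algebraMap (ZMod 25) R8 c * y := Algebra.smul_def c y

/-- `w ^ (i : ℕ) = b4 i`. -/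
theorem w_pow_eq_b4 (i : Fin 4) : w ^ (i : ℕ) = b4 i := (b4_apply i).symm

/-- The coordinates of an explicit combination. -/
theorem coords_comb (c₀ c₁ c₂ c₃ : ZMod 25) (i : Fin 4) :
    b4.repr (c₀ • (1 : R8) + c₁ • w + c₂ • w ^ 2 + c₃ • w ^ 3) i = ![c₀, c₁, c₂, c₃] i := by
  have h0 : (1 : R8) = b4 0 := by rw [← w_pow_eq_b4]; simp
  have h1 : w = b4 1 := by rw [← w_pow_eq_b4]; simp
  have h2 : w ^ 2 = b4 2 := by rw [← w_pow_eq_b4]; rfl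
  have h3 : w ^ 3 = b4 3 := by rw [← w_pow_eq_b4]; rfl
  rw [h3, h2, h1, h0, map_add, map_add, map_add, map_smul, map_smul, map_smul, map_smul,
    Module.Basis.repr_self, Module.Basis.repr_self, Module.Basis.repr_self, Module.Basis.repr_self]
  simp only [Finsupp.coe_add, Finsupp.coe_smul, Pi.add_apply, Pi.smul_apply, Finsupp.single_apply, smul_eq_mul]
  fin_cases i <;> simp

/-- `top (c₀ + c₁ w + c₂ w² + c₃ w³) = c₃`. -/
theorem top_comb (c₀ c₁ c₂ c₃ : ZMod 25) :
    top (c₀ • (1 : R8) + c₁ • w + c₂ • w ^ 2 + c₃ • w ^ 3) = c₃ := by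
  rw [top_apply, coords_comb]
  rfl

/-- Every `y` is its coordinate combination. -/
theorem eq_comb (y : R8) :
    y = (b4.repr y 0) • (1 : R8) + (b4.repr y 1) • w + (b4.repr y 2) • w ^ 2 + (b4.repr y 3) • w ^ 3 := by
  conv_lhs => rw [← b4.sum_repr y]
  rw [Fin.sum_univ_four, b4_apply, b4_apply, b4_apply, b4_apply]
  simp

/-- **The top coordinates of `w^k`, `k ≤ 6`**: `0, 0, 0, 1, 0, 20, 0` (`w⁴ = 20 + 20w²`, `w⁵ = 20w + 20w³`,
`w⁶ = 20w²`). -/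
theorem top_w_pow (k : ℕ) (hk : k ≤ 6) : top (w ^ k) = ![0, 0, 0, 1, 0, 20, 0] ⟨k, by omega⟩ := by
  have hrel := w_rel
  have h25 := twentyfive_eq_zero
  have h20 : algebraMap (ZMod 25) R8 20 = 20 := map_ofNat _ _
  interval_cases k
  · rw [show w ^ 0 = (1 : ZMod 25) • (1 : R8) + (0 : ZMod 25) • w + (0 : ZMod 25) • w ^ 2 + (0 : ZMod 25) • w ^ 3 by
      simp only [smul_eq_num, map_zero, map_one]; ring]
    rw [top_comb]; rfl
  · rw [show w ^ 1 = (0 : ZMod 25) • (1 : R8) + (1 : ZMod 25) • w + (0 : ZMod 25) • w ^ 2 + (0 : ZMod 25) • w ^ 3 by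
      simp only [smul_eq_num, map_zero, map_one]; ring]
    rw [top_comb]; rfl
  · rw [show w ^ 2 = (0 : ZMod 25) • (1 : R8) + (0 : ZMod 25) • w + (1 : ZMod 25) • w ^ 2 + (0 : ZMod 25) • w ^ 3 by
      simp only [smul_eq_num, map_zero, map_one]; ring]
    rw [top_comb]; rfl
  · rw [show w ^ 3 = (0 : ZMod 25) • (1 : R8) + (0 : ZMod 25) • w + (0 : ZMod 25) • w ^ 2 + (1 : ZMod 25) • w ^ 3 by
      simp only [smul_eq_num, map_zero, map_one]; ring]
    rw [top_comb]; rfl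
  · rw [show w ^ 4 = (20 : ZMod 25) • (1 : R8) + (0 : ZMod 25) • w + (20 : ZMod 25) • w ^ 2 + (0 : ZMod 25) • w ^ 3 by
      simp only [smul_eq_num, map_zero, h20]; linear_combination hrel - (w ^ 2 + 1) * h25]
    rw [top_comb]; rfl
  · rw [show w ^ 5 = (0 : ZMod 25) • (1 : R8) + (20 : ZMod 25) • w + (0 : ZMod 25) • w ^ 2 + (20 : ZMod 25) • w ^ 3 by
      simp only [smul_eq_num, map_zero, h20]; linear_combination w * hrel - (w ^ 3 + w) * h25]
    rw [top_comb]; rfl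
  · rw [show w ^ 6 = (0 : ZMod 25) • (1 : R8) + (0 : ZMod 25) • w + (20 : ZMod 25) • w ^ 2 + (0 : ZMod 25) • w ^ 3 by
      simp only [smul_eq_num, map_zero, h20]; linear_combination (w ^ 2 - 5) * hrel + h25]
    rw [top_comb]; rfl

/-! ### The Gram matrix of `(a, b) ↦ top(ab)` and the primitivity of `ψ̃` -/

/-- The Gram matrix `G i j = top (w^i w^j)`. -/
def G : Matrix (Fin 4) (Fin 4) (ZMod 25) := !![0, 0, 0, 1; 0, 0, 1, 0; 0, 1, 0, 20; 1, 0, 20, 0]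

/-- The inverse of `G` over `ℤ/25`. -/
def H : Matrix (Fin 4) (Fin 4) (ZMod 25) := !![0, 5, 0, 1; 5, 0, 1, 0; 0, 1, 0, 0; 1, 0, 0, 0]

/-- **`G * H = 1`.** -/
theorem G_mul_H : G * H = 1 := by
  ext i j
  fin_cases i <;> fin_cases j <;> simp [G, H, Matrix.mul_apply, Fin.sum_univ_four] <;> decide

/-- `G` is the Gram matrix: `top (w^i w^j) = G i j`. -/
theorem top_mul_pow (i j : Fin 4) : top (w ^ (i : ℕ) * w ^ (j : ℕ)) = G i j := by
  rw [← pow_add, top_w_pow _ (by omega)]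
  fin_cases i <;> fin_cases j <;> rfl

/-- `top (a w^j) = Σ_i (coords a)_i G i j`. -/
theorem top_mul_eq_vecMul (a : R8) (j : Fin 4) :
    top (a * w ^ (j : ℕ)) = Matrix.vecMul (⇑(b4.repr a)) G j := by
  conv_lhs => rw [← b4.sum_repr a]
  simp only [b4_apply, Finset.sum_mul, smul_mul_assoc]
  show topL _ = _
  rw [map_sum]
  simp only [map_smul, smul_eq_mul]
  rw [Matrix.vecMul, dotProduct]
  refine Finset.sum_congr rfl fun i _ => ?_
  rw [show topL (w ^ (i : ℕ) * w ^ (j : ℕ)) = top (w ^ (i : ℕ) * w ^ (j : ℕ)) from rfl, top_mul_pow]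

/-- **The pairing is non-degenerate**: `a ≠ 0 → ∃ j, top (a w^j) ≠ 0`. -/
theorem exists_top_ne_zero {a : R8} (ha : a ≠ 0) : ∃ j : Fin 4, top (a * w ^ (j : ℕ)) ≠ 0 := by
  by_contra hcon
  have hcon' : ∀ j : Fin 4, top (a * w ^ (j : ℕ)) = 0 := fun j => by
    by_contra hj
    exact hcon ⟨j, hj⟩
  have hv : Matrix.vecMul (⇑(b4.repr a)) G = 0 := by
    funext j
    rw [← top_mul_eq_vecMul, hcon' j]
    rfl
  have hc : ⇑(b4.repr a) = 0 := by
    calc ⇑(b4.repr a) = Matrix.vecMul (⇑(b4.repr a)) 1 := (Matrix.vecMul_one _).symm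
      _ = Matrix.vecMul (⇑(b4.repr a)) (G * H) := by rw [G_mul_H]
      _ = Matrix.vecMul (Matrix.vecMul (⇑(b4.repr a)) G) H := (Matrix.vecMul_vecMul _ _ _).symm
      _ = 0 := by rw [hv, Matrix.zero_vecMul]
  apply ha
  have : b4.repr a = 0 := DFunLike.coe_injective hc
  exact b4.repr.injective (by rw [this, map_zero])

/-- A primitive `25`-th root of unity `ζ₂₅ = e(1/25)`. -/
def ζ25 : ℂ := Complex.exp (2 * Real.pi * Complex.I / 25)

/-- `ζ₂₅` is a primitive `25`-th root of unity. -/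
theorem ζ25_isPrimitiveRoot : IsPrimitiveRoot ζ25 25 := Complex.isPrimitiveRoot_exp 25 (by norm_num)

/-- The standard character `ψ₂₅(x) = ζ₂₅^x` of `ℤ/25`. -/
def psi25 : AddChar (ZMod 25) ℂ :=
  AddChar.zmodChar 25 ((IsPrimitiveRoot.iff_def ζ25 25).mp ζ25_isPrimitiveRoot).left

/-- `ψ₂₅` is primitive. -/
theorem psi25_isPrimitive : psi25.IsPrimitive :=
  AddChar.zmodChar_primitive_of_primitive_root 25 ζ25_isPrimitiveRoot

/-- `ψ₂₅ t = 1 ↔ t = 0`. -/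
theorem psi25_eq_one_iff (t : ZMod 25) : psi25 t = 1 ↔ t = 0 := by
  rw [psi25, AddChar.zmodChar_apply, ζ25_isPrimitiveRoot.pow_eq_one_iff_dvd, ← ZMod.val_eq_zero]
  constructor
  · intro h
    exact Nat.eq_zero_of_dvd_of_lt h (ZMod.val_lt t)
  · intro h
    rw [h]
    exact dvd_zero 25

/-- `top` as an additive map. -/
def topHom : R8 →+ ZMod 25 := topL.toAddMonoidHom

/-- **The additive character `ψ̃ = ψ₂₅ ∘ top` of `𝒪/𝔭⁸`.** -/
def psiTilde : AddChar R8 ℂ := psi25.compAddMonoidHom topHom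

/-- `ψ̃ y = ψ₂₅ (top y)`. -/
theorem psiTilde_apply (y : R8) : psiTilde y = psi25 (top y) := rfl

/-- **`ψ̃` is primitive.** -/
theorem psiTilde_isPrimitive : psiTilde.IsPrimitive := by
  intro a ha h1
  obtain ⟨j, hj⟩ := exists_top_ne_zero ha
  have := DFunLike.congr_fun h1 (w ^ (j : ℕ))
  rw [AddChar.mulShift_apply, AddChar.one_apply, psiTilde_apply, psi25_eq_one_iff] at this
  exact hj this

/-- `ψ̃(a ·) = ψ̃(b ·)` forces `a = b`. -/
theorem mulShift_psiTilde_injective {a b : R8}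
    (h : AddChar.mulShift psiTilde a = AddChar.mulShift psiTilde b) : a = b := by
  by_contra hne
  apply psiTilde_isPrimitive (sub_ne_zero.2 hne)
  have : AddChar.mulShift psiTilde (a - b) = AddChar.mulShift psiTilde a * AddChar.mulShift psiTilde (-b) := by
    rw [AddChar.mulShift_mul, sub_eq_add_neg]
  rw [this, h, AddChar.mulShift_mul, add_neg_cancel, AddChar.mulShift_zero]

/-! ### `σ`-compatibility of `ψ̃`: `top` is odd -/

/-- `σ` on an explicit combination: the odd coordinates change sign. -/
theorem conj_comb (c₀ c₁ c₂ c₃ : ZMod 25) :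
    conj (c₀ • (1 : R8) + c₁ • w + c₂ • w ^ 2 + c₃ • w ^ 3) =
      c₀ • (1 : R8) + (-c₁) • w + c₂ • w ^ 2 + (-c₃) • w ^ 3 := by
  rw [map_add, map_add, map_add, map_smul, map_smul, map_smul, map_smul, map_one, map_pow, map_pow, conj_w,
    neg_sq, show (-w) ^ 3 = -(w ^ 3) by ring, smul_neg, smul_neg, neg_smul, neg_smul]

/-- **`top ∘ σ = −top`.** -/
theorem top_conj (y : R8) : top (conj y) = -top y := by
  rw [eq_comb y, conj_comb, top_comb, top_comb]

/-- **`ψ̃ ∘ σ = ψ̃ ∘ (−1 ·)`** — the hypothesis `hψ` of gen 3's `conjDual_ramified` at `c = 8`. -/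
theorem psiTilde_conj (y : R8) : psiTilde (conj y) = psiTilde (-y) := by
  rw [psiTilde_apply, psiTilde_apply, top_conj, top_neg]

end EightModel

end Summit.Ventures.HodgeRepro.PeriodCloser

end
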